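import Literature.Topology.Immersions.DoublePointsGenericity
import Literature.Topology.Immersions.SurjectiveDifferentialOpen
import Literature.Geometry.Manifold.StabilityOfEmbeddings
import HarnessLib

/-!
# The double-point manifold of a self-transverse immersion into Euclidean space

Topic `Literature/Topology/Immersions`. For a `C^∞` immersion `f : M → ℝ^q` of a compact
`n`-manifold all of whose double points are transverse (`DoublePointsGenericity.lean`,
`GenericImmersionPerturbation.lean`), the set of ordered double pairs

  `Δ̃(f) = {(x, y) ∈ M × M | x ≠ y, f x = f y}`

is a compact `C^∞` manifold of dimension `n + n - q`, the two projections `π₁, π₂ : Δ̃ → M`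
are `C^∞` immersions, and `T_{(x,y)} Δ̃ = {(ξ, η) | df_x ξ = df_y η}` (Hirsch, *Differential
Topology* (1976), Ch. 1 §3 Thm. 3.3 / Ch. 3 §2 Ex. 1: the preimage of the diagonal under the
transverse map `f × f`; for `M⁴ ↬ ℝ⁶` this is the immersed double-point surface `Δ` of Kirby,
*The Topology of 4-Manifolds* (1989), Ch. VI, p. 40: *"`Δ²` is an immersed, oriented
2-manifold in `M` which double covers its image `f(Δ)`"*). Here:

* `exists_isOpen_diagonal_injOn` — an immersion is injective near the diagonal: there is an open
  `O ⊇ diagonal` in `M × M` on which `f x = f y ⇒ x = y` (Hirsch Ch. 2 §1 Lemma 1.3, from the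
  tree's `Literature.Geometry.Manifold.exists_isOpen_eventually_injOn_and_injective_mfderiv`);
* `exists_doublePointManifold` — **the double-point manifold**: a compact Hausdorff second
  countable `C^∞` `m`-manifold `Z` (`n + n = m + q`) with `C^∞` maps `π₁ π₂ : Z → M` such that
  `z ↦ (π₁ z, π₂ z)` is a bijection onto `Δ̃(f)`, both `πᵢ` are immersions,
  `(ξ, η)` is tangent (`= (dπ₁ u, dπ₂ u)`) iff `df_{π₁ z} ξ = df_{π₂ z} η`, and the swap
  `(x, y) ↦ (y, x)` lifts to a `C^∞` map `τ : Z → Z` (`π₁ ∘ τ = π₂`, `π₂ ∘ τ = π₁`; smoothness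
  by Mathlib's `ContMDiff.iff_comp_isImmersion` for the immersion `Z → M × M`);
* `surjective_add_ediff_of_triplePoints_transverse` — at a triple point the two sheets of
  `π₁ : Z → M` are transverse.

Construction: `Δ̃(f)` is the zero set of `F(x, y) = f x - f y` on the open set
`{x ≠ y} ∩ {dF onto}` of `M × M` (re-charted on `ℝⁿ⁺ⁿ` by `Remodel`; the second condition holds
at every double pair by transversality and is open by `isOpen_setOf_surjective_mfderiv`), to
which the tree's regular preimage theorem `Literature.Topology.FourManifolds.exists_regularPreimage`
applies; compactness because `Δ̃(f)` is closed in `M × M` (it avoids the neighbourhood `O` of the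
diagonal).

Everything here is proved; no definitions, no named facts.

## References

* M. W. Hirsch, *Differential Topology*, GTM 33 (1976), Ch. 1 §3 Thms. 3.2–3.3, Ch. 2 §1
  Lemma 1.3, Ch. 3 §2 Ex. 1. [HirschDT1976]
* R. C. Kirby, *The Topology of 4-Manifolds*, LNM 1374 (1989), Ch. VI, p. 40. [Kirby1989]
-/

open scoped Manifold ContDiff Topology
open Set Function Module

noncomputable section

universe u

namespace Literature.Topology.Immersions

/-- Local notation: `𝔼 n` is the model Euclidean space `EuclideanSpace ℝ (Fin n)`. -/
local notation "𝔼 " n:arg => EuclideanSpace ℝ (Fin n)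

open Literature.Topology.FourManifolds (exists_regularPreimage injective_mfderiv_of_isImmersionAt')
open Literature.Geometry.Manifold (exists_isOpen_eventually_injOn_and_injective_mfderiv)
open Literature.Geometry.Manifold.OpenSubmanifold (mfderiv_subtype_val mdifferentiableAt_subtype_val)

variable {n q : ℕ} {M : Type u} [TopologicalSpace M] [ChartedSpace (𝔼 n) M]
  [T2Space M] [SecondCountableTopology M] [IsManifold (𝓡 n) ∞ M]

omit [T2Space M] [SecondCountableTopology M] in
/-- **An immersion is injective near the diagonal**: for a `C^∞` immersion `f : M → F'` there is
an open set `O ⊇ diagonal` of `M × M` such that `f x = f y`, `(x, y) ∈ O` imply `x = y`.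
[cite: HirschDT1976, Ch. 2 §1 Lemma 1.3] -/
theorem exists_isOpen_diagonal_injOn {f : M → 𝔼 q} (hf : ContMDiff (𝓡 n) (𝓡 q) ∞ f)
    (himm : ∀ x, Injective (mfderiv (𝓡 n) (𝓡 q) f x)) :
    ∃ O : Set (M × M), IsOpen O ∧ diagonal M ⊆ O ∧ ∀ p ∈ O, f p.1 = f p.2 → p.1 = p.2 := by
  -- local injectivity at each point (constant family over the parameter line `ℝ`)
  have hloc : ∀ x₀ : M, ∃ N : Set M, IsOpen N ∧ x₀ ∈ N ∧ InjOn f N := by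
    intro x₀
    have hΦ : ContMDiffOn (𝓘(ℝ, ℝ).prod (𝓡 n)) 𝓘(ℝ, 𝔼 q) ∞ (uncurry fun (_ : ℝ) (x : M) => f x)
        ((univ : Set ℝ) ×ˢ (univ : Set M)) := (hf.comp contMDiff_snd).contMDiffOn
    obtain ⟨N, hNo, hx₀, hev⟩ := exists_isOpen_eventually_injOn_and_injective_mfderiv
      (J := 𝓘(ℝ, ℝ)) (I := 𝓡 n) (n := ∞) isOpen_univ hΦ (by simp) (mem_univ (0 : ℝ)) x₀ (himm x₀)
    exact ⟨N, hNo, hx₀, (hev.self_of_nhds).1⟩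
  choose N hNo hxN hinj using hloc
  refine ⟨⋃ x, N x ×ˢ N x, isOpen_iUnion fun x => (hNo x).prod (hNo x), ?_, ?_⟩
  · rintro ⟨x, y⟩ hxy
    have hxy' : x = y := hxy
    subst hxy'
    exact mem_iUnion.2 ⟨x, hxN x, hxN x⟩
  · rintro ⟨x, y⟩ hp hxy
    obtain ⟨x₀, hx, hy⟩ := mem_iUnion.1 hp
    exact hinj x₀ hx hy hxy

/-- **The double-point manifold of a self-transverse immersion** `f : M → ℝ^q` of a compact
`n`-manifold (`n + n = m + q`): a compact `C^∞` `m`-manifold `Z` with `C^∞` immersions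
`π₁, π₂ : Z → M` such that `z ↦ (π₁ z, π₂ z)` is a bijection onto
`{(x, y) | x ≠ y, f x = f y}` and `(ξ, η) = (dπ₁ u, dπ₂ u)` for some `u` iff `df_{π₁ z} ξ = df_{π₂ z} η`.
[cite: HirschDT1976, Ch. 1 §3 Thm. 3.3 and Ch. 3 §2 Ex. 1; Kirby1989, Ch. VI p. 40] -/
theorem exists_doublePointManifold [CompactSpace M] {m : ℕ} (hm : n + n = m + q) {f : M → 𝔼 q}
    (hf : ContMDiff (𝓡 n) (𝓡 q) ∞ f) (himm : ∀ x, Injective (mfderiv (𝓡 n) (𝓡 q) f x))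
    (hdp : ∀ x y : M, x ≠ y → f x = f y →
      ∀ w : 𝔼 q, ∃ ζ : 𝔼 n × 𝔼 n, ediff n q f x ζ.1 - ediff n q f y ζ.2 = w) :
    ∃ (Z : Type u) (_ : TopologicalSpace Z) (_ : T2Space Z) (_ : SecondCountableTopology Z)
      (_ : CompactSpace Z) (_ : ChartedSpace (𝔼 m) Z) (_ : IsManifold (𝓡 m) ∞ Z) (π₁ π₂ : Z → M),
      ContMDiff (𝓡 m) (𝓡 n) ∞ π₁ ∧ ContMDiff (𝓡 m) (𝓡 n) ∞ π₂ ∧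
      (∀ z, π₁ z ≠ π₂ z) ∧ (∀ z, f (π₁ z) = f (π₂ z)) ∧
      Injective (fun z => (π₁ z, π₂ z)) ∧
      (∀ x y : M, x ≠ y → f x = f y → ∃ z, π₁ z = x ∧ π₂ z = y) ∧
      (∀ (z : Z) (ζ : 𝔼 n × 𝔼 n), ediff n q f (π₁ z) ζ.1 = ediff n q f (π₂ z) ζ.2 ↔
        ∃ u : 𝔼 m, (mfderiv (𝓡 m) (𝓡 n) π₁ z u, mfderiv (𝓡 m) (𝓡 n) π₂ z u) = ζ) ∧
      (∀ z, Injective (mfderiv (𝓡 m) (𝓡 n) π₁ z)) ∧ (∀ z, Injective (mfderiv (𝓡 m) (𝓡 n) π₂ z)) ∧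
      ∃ τ : Z → Z, ContMDiff (𝓡 m) (𝓡 m) ∞ τ ∧ (∀ z, π₁ (τ z) = π₂ z) ∧ (∀ z, π₂ (τ z) = π₁ z) := by
  -- `M × M` re-charted on `ℝⁿ⁺ⁿ`, and the map `F (x, y) = f x - f y`
  let L : (𝔼 n × 𝔼 n) ≃L[ℝ] 𝔼 (n + n) := ContinuousLinearEquiv.ofFinrankEq finrank_prod_self_eq
  let I₂ := (𝓡 n).prod (𝓡 n)
  let V : Type u := Remodel I₂ L (M × M)
  let oR : V → M × M := Remodel.ofRemodel
  let tR : M × M → V := Remodel.toRemodel I₂ L (M × M)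
  have hoR : ContMDiff (𝓡 (n + n)) I₂ ∞ oR := Remodel.contMDiff_ofRemodel _ _
  have hoRd : ∀ v, MDifferentiableAt (𝓡 (n + n)) I₂ oR v := fun v => (hoR v).mdifferentiableAt (by simp)
  have hoRbij : ∀ v, Bijective (mfderiv (𝓡 (n + n)) I₂ oR v) := fun v =>
    Remodel.bijective_mfderiv_ofRemodel I₂ L (M := M × M) (n := ∞) (by simp) v
  let Fs : M × M → 𝔼 q := fun p => f p.1 - f p.2
  have hfd : ∀ x, MDifferentiableAt (𝓡 n) (𝓡 q) f x := fun x => (hf x).mdifferentiableAt (by simp)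
  have hFs : ContMDiff I₂ (𝓡 q) ∞ Fs := (hf.comp contMDiff_fst).sub (hf.comp contMDiff_snd)
  have hFsd : ∀ p, MDifferentiableAt I₂ (𝓡 q) Fs p := fun p => (hFs p).mdifferentiableAt (by simp)
  let F : V → 𝔼 q := Fs ∘ oR
  have hF : ContMDiff (𝓡 (n + n)) (𝓡 q) ∞ F := hFs.comp hoR
  have hFd : ∀ v, MDifferentiableAt (𝓡 (n + n)) (𝓡 q) F v := fun v => (hF v).mdifferentiableAt (by simp)
  have hFcomp : ∀ v ξ, mfderiv (𝓡 (n + n)) (𝓡 q) F v ξ =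
      mfderiv I₂ (𝓡 q) Fs (oR v) (mfderiv (𝓡 (n + n)) I₂ oR v ξ) := fun v ξ => by
    rw [show F = Fs ∘ oR from rfl, mfderiv_comp v (g := Fs) (f := oR) (hFsd _) (hoRd v)]
    rfl
  have hFsapply : ∀ (x y : M) (ζ : 𝔼 n × 𝔼 n), mfderiv I₂ (𝓡 q) Fs (x, y) ζ =
      ediff n q f x ζ.1 - ediff n q f y ζ.2 := fun x y ζ => ediff_sub_fst_snd_apply hfd x y ζ
  -- the open set `{x ≠ y} ∩ {dF onto}` as an open submanifold
  have hWo : IsOpen ({v : V | (oR v).1 ≠ (oR v).2} ∩ {v | Surjective (mfderiv (𝓡 (n + n)) (𝓡 q) F v)}) := by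
    refine IsOpen.inter ?_ (isOpen_setOf_surjective_mfderiv hF)
    have hc : Continuous fun v : V => ((oR v).1, (oR v).2) := Remodel.continuous_ofRemodel _ _ _
    exact (isClosed_diagonal.preimage hc).isOpen_compl
  let U : TopologicalSpace.Opens V :=
    ⟨{v : V | (oR v).1 ≠ (oR v).2} ∩ {v | Surjective (mfderiv (𝓡 (n + n)) (𝓡 q) F v)}, hWo⟩
  let F' : U → 𝔼 q := F ∘ Subtype.val
  have hval : ContMDiff (𝓡 (n + n)) (𝓡 (n + n)) ∞ (Subtype.val : U → V) := contMDiff_subtype_val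
  have hF' : ContMDiff (𝓡 (n + n)) (𝓡 q) ∞ F' := hF.comp hval
  have hF'comp : ∀ (w : U) ξ, mfderiv (𝓡 (n + n)) (𝓡 q) F' w ξ =
      mfderiv (𝓡 (n + n)) (𝓡 q) F w.1 ξ := fun w ξ => by
    rw [show F' = F ∘ Subtype.val from rfl,
      mfderiv_comp w (g := F) (f := (Subtype.val : U → V)) (hFd _) (mdifferentiableAt_subtype_val w)]
    show mfderiv (𝓡 (n + n)) (𝓡 q) F w.1 (mfderiv (𝓡 (n + n)) (𝓡 (n + n))
      (Subtype.val : U → V) w ξ) = _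
    rw [DFunLike.congr_fun (mfderiv_subtype_val (I := 𝓡 (n + n)) w) ξ]
    rfl
  have hF'surj : ∀ w : U, Surjective (mfderiv (𝓡 (n + n)) (𝓡 q) F' w) := fun w c => by
    obtain ⟨ξ, hξ⟩ := w.2.2 c
    exact ⟨ξ, by rw [hF'comp]; exact hξ⟩
  -- the regular preimage
  obtain ⟨Z, _, _, _, _, _, e, he, hrange, hker⟩ :=
    exists_regularPreimage q m (n + n) hm U F' hF' hF'surj 0
  have hes : ContMDiff (𝓡 m) (𝓡 (n + n)) ∞ e := he.contMDiff
  have hed : ∀ z, MDifferentiableAt (𝓡 m) (𝓡 (n + n)) e z := fun z => (hes z).mdifferentiableAt (by simp)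
  have heinj : ∀ z, Injective (mfderiv (𝓡 m) (𝓡 (n + n)) e z) := fun z =>
    injective_mfderiv_of_isImmersionAt' (he.isImmersion.isImmersionAt z)
  -- the projections
  let P : Z → M × M := fun z => oR (e z).1
  have hP : ContMDiff (𝓡 m) I₂ ∞ P := hoR.comp (hval.comp hes)
  let π₁ : Z → M := fun z => (P z).1
  let π₂ : Z → M := fun z => (P z).2
  have hπ₁ : ContMDiff (𝓡 m) (𝓡 n) ∞ π₁ := contMDiff_fst.comp hP
  have hπ₂ : ContMDiff (𝓡 m) (𝓡 n) ∞ π₂ := contMDiff_snd.comp hP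
  -- the differential of `P` is `doR ∘ dval ∘ de`
  have hPd : ∀ z u, mfderiv (𝓡 m) I₂ P z u =
      mfderiv (𝓡 (n + n)) I₂ oR (e z).1 (mfderiv (𝓡 m) (𝓡 (n + n)) e z u) := by
    intro z u
    have h1 : mfderiv (𝓡 m) (𝓡 (n + n)) (Subtype.val ∘ e) z =
        (mfderiv (𝓡 (n + n)) (𝓡 (n + n)) (Subtype.val : U → V) (e z)).comp
          (mfderiv (𝓡 m) (𝓡 (n + n)) e z) :=
      mfderiv_comp z (g := (Subtype.val : U → V)) (f := e) (mdifferentiableAt_subtype_val _) (hed z)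
    have h2 : mfderiv (𝓡 m) I₂ P z = (mfderiv (𝓡 (n + n)) I₂ oR (e z).1).comp
        (mfderiv (𝓡 m) (𝓡 (n + n)) (Subtype.val ∘ e) z) :=
      mfderiv_comp z (g := oR) (f := Subtype.val ∘ e) (hoRd _) ((hval.comp hes) z |>.mdifferentiableAt (by simp))
    rw [h2]
    show mfderiv (𝓡 (n + n)) I₂ oR (e z).1 (mfderiv (𝓡 m) (𝓡 (n + n)) (Subtype.val ∘ e) z u) = _
    rw [h1]
    show mfderiv (𝓡 (n + n)) I₂ oR (e z).1 (mfderiv (𝓡 (n + n)) (𝓡 (n + n)) (Subtype.val : U → V) (e z)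
      (mfderiv (𝓡 m) (𝓡 (n + n)) e z u)) = _
    rw [DFunLike.congr_fun (mfderiv_subtype_val (I := 𝓡 (n + n)) (e z)) (mfderiv (𝓡 m) (𝓡 (n + n)) e z u)]
    rfl
  have hπd : ∀ z u, (mfderiv (𝓡 m) (𝓡 n) π₁ z u, mfderiv (𝓡 m) (𝓡 n) π₂ z u) =
      mfderiv (𝓡 m) I₂ P z u := by
    intro z u
    have hPz : MDifferentiableAt (𝓡 m) I₂ P z := (hP z).mdifferentiableAt (by simp)
    have h1 : mfderiv (𝓡 m) (𝓡 n) (Prod.fst ∘ P) z =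
        (mfderiv I₂ (𝓡 n) (Prod.fst : M × M → M) (P z)).comp (mfderiv (𝓡 m) I₂ P z) :=
      mfderiv_comp z (g := (Prod.fst : M × M → M)) (f := P) mdifferentiableAt_fst hPz
    have h2 : mfderiv (𝓡 m) (𝓡 n) (Prod.snd ∘ P) z =
        (mfderiv I₂ (𝓡 n) (Prod.snd : M × M → M) (P z)).comp (mfderiv (𝓡 m) I₂ P z) :=
      mfderiv_comp z (g := (Prod.snd : M × M → M)) (f := P) mdifferentiableAt_snd hPz
    rw [show π₁ = Prod.fst ∘ P from rfl, show π₂ = Prod.snd ∘ P from rfl, h1, h2, mfderiv_fst,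
      mfderiv_snd]
    rfl
  -- compactness: the double pairs avoid a neighbourhood of the diagonal
  obtain ⟨O, hOo, hdiag, hOinj⟩ := exists_isOpen_diagonal_injOn hf himm
  have hrange_eq : (Subtype.val '' range e : Set V) = {v | Fs (oR v) = 0} ∩ (oR ⁻¹' O)ᶜ := by
    ext v
    constructor
    · rintro ⟨w, ⟨z, rfl⟩, rfl⟩
      have h0 : F' (e z) = 0 := by
        have : e z ∈ range e := mem_range_self z
        rw [hrange] at this
        exact this
      refine ⟨h0, fun hO => (e z).2.1 (hOinj _ hO (sub_eq_zero.1 h0))⟩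
    · rintro ⟨h0, hO⟩
      have hne : (oR v).1 ≠ (oR v).2 := fun h => hO (hdiag (mem_diagonal_iff.2 h))
      have hsurj : Surjective (mfderiv (𝓡 (n + n)) (𝓡 q) F v) := by
        intro c
        obtain ⟨ζ, hζ⟩ := hdp _ _ hne (sub_eq_zero.1 h0) c
        obtain ⟨ξ, hξ⟩ := (hoRbij v).2 ζ
        refine ⟨ξ, ?_⟩
        rw [hFcomp, hξ]
        rw [show oR v = ((oR v).1, (oR v).2) from rfl, hFsapply]
        exact hζ
      have hmem : (⟨v, hne, hsurj⟩ : U) ∈ range e := by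
        rw [hrange]
        exact h0
      obtain ⟨z, hz⟩ := hmem
      exact ⟨e z, mem_range_self z, by rw [hz]⟩
  have hclosed : IsClosed ((Subtype.val '' range e : Set V)) := by
    rw [hrange_eq]
    exact (isClosed_singleton.preimage (hFs.continuous.comp (Remodel.continuous_ofRemodel _ _ _))).inter
      (hOo.preimage (Remodel.continuous_ofRemodel _ _ _)).isClosed_compl
  haveI : CompactSpace Z := by
    refine ⟨?_⟩
    have h1 : IsCompact (Subtype.val '' range e : Set V) := hclosed.isCompact
    have h2 : IsCompact (range e) :=
      (Topology.IsEmbedding.subtypeVal.isCompact_iff).2 h1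
    rw [← image_univ] at h2
    exact he.isEmbedding.isCompact_iff.2 h2
  -- `f π₁ = f π₂` and the tangent space of `Z`
  have hlevel : ∀ z, f (π₁ z) = f (π₂ z) := fun z => by
    have : e z ∈ range e := mem_range_self z
    rw [hrange] at this
    exact sub_eq_zero.1 this
  have htan : ∀ (z : Z) (ζ : 𝔼 n × 𝔼 n), ediff n q f (π₁ z) ζ.1 = ediff n q f (π₂ z) ζ.2 ↔
      ∃ u : 𝔼 m, (mfderiv (𝓡 m) (𝓡 n) π₁ z u, mfderiv (𝓡 m) (𝓡 n) π₂ z u) = ζ := by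
    intro z ζ
    constructor
    · intro hζ
      obtain ⟨ξ, hξ⟩ := (hoRbij (e z).1).2 ζ
      have h0 : mfderiv (𝓡 (n + n)) (𝓡 q) F' (e z) ξ = 0 := by
        rw [hF'comp, hFcomp, hξ]
        rw [show oR (e z).1 = (π₁ z, π₂ z) from rfl, hFsapply]
        exact sub_eq_zero.2 hζ
      obtain ⟨u, hu⟩ := (hker z ξ).1 h0
      exact ⟨u, by rw [hπd, hPd, hu, hξ]⟩
    · rintro ⟨u, hu⟩
      have h0 : mfderiv (𝓡 (n + n)) (𝓡 q) F' (e z) (mfderiv (𝓡 m) (𝓡 (n + n)) e z u) = 0 :=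
        (hker z _).2 ⟨u, rfl⟩
      rw [hF'comp, hFcomp, ← hPd, ← hπd, hu] at h0
      rw [show oR (e z).1 = (π₁ z, π₂ z) from rfl, hFsapply] at h0
      exact sub_eq_zero.1 h0
  -- both projections are immersions
  have hvzero : ∀ (z : Z) (v : 𝔼 m), mfderiv (𝓡 m) (𝓡 n) π₁ z v = 0 →
      mfderiv (𝓡 m) (𝓡 n) π₂ z v = 0 → v = 0 := by
    intro z v h1 h2
    have h3 : mfderiv (𝓡 m) I₂ P z v = 0 := by
      rw [← hπd, h1, h2]
      rfl
    rw [hPd] at h3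
    have h4 : mfderiv (𝓡 m) (𝓡 (n + n)) e z v = 0 :=
      (injective_iff_map_eq_zero _).1 (hoRbij _).1 _ h3
    exact (injective_iff_map_eq_zero _).1 (heinj z) _ h4
  have hkey : ∀ (z : Z) (v : 𝔼 m), ediff n q f (π₁ z) (mfderiv (𝓡 m) (𝓡 n) π₁ z v) =
      ediff n q f (π₂ z) (mfderiv (𝓡 m) (𝓡 n) π₂ z v) := fun z v => (htan z _).2 ⟨v, rfl⟩
  have himm₁ : ∀ z, Injective (mfderiv (𝓡 m) (𝓡 n) π₁ z) := fun z =>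
    (injective_iff_map_eq_zero _).2 fun v hv => by
      have e1 : ediff n q f (π₁ z) (mfderiv (𝓡 m) (𝓡 n) π₁ z v) = 0 := by
        rw [hv]
        exact map_zero _
      have h2 : ediff n q f (π₂ z) (mfderiv (𝓡 m) (𝓡 n) π₂ z v) = 0 := (hkey z v).symm.trans e1
      exact hvzero z v hv ((injective_iff_map_eq_zero _).1 (himm (π₂ z)) _ h2)
  have himm₂ : ∀ z, Injective (mfderiv (𝓡 m) (𝓡 n) π₂ z) := fun z =>
    (injective_iff_map_eq_zero _).2 fun v hv => by
      have e2 : ediff n q f (π₂ z) (mfderiv (𝓡 m) (𝓡 n) π₂ z v) = 0 := by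
        rw [hv]
        exact map_zero _
      have h1 : ediff n q f (π₁ z) (mfderiv (𝓡 m) (𝓡 n) π₁ z v) = 0 := (hkey z v).trans e2
      exact hvzero z v ((injective_iff_map_eq_zero _).1 (himm (π₁ z)) _ h1) hv
  -- injectivity of `(π₁, π₂)` and every double pair is hit
  have hPinj : Injective fun z => (π₁ z, π₂ z) := by
    intro z z' hzz'
    apply he.isEmbedding.injective
    apply Subtype.ext
    apply (Remodel.ofRemodel_bijective (I := I₂) (L := L) (M := M × M)).1
    exact Prod.ext (congrArg Prod.fst hzz') (congrArg Prod.snd hzz')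
  have hhit : ∀ x y : M, x ≠ y → f x = f y → ∃ z, π₁ z = x ∧ π₂ z = y := by
    intro x y hxy hfxy
    have hsurj : Surjective (mfderiv (𝓡 (n + n)) (𝓡 q) F (tR (x, y))) := by
      intro c
      obtain ⟨ζ, hζ⟩ := hdp x y hxy hfxy c
      obtain ⟨ξ, hξ⟩ := (hoRbij (tR (x, y))).2 ζ
      refine ⟨ξ, ?_⟩
      rw [hFcomp, hξ]
      exact (hFsapply x y ζ).trans hζ
    have hmem : (⟨tR (x, y), hxy, hsurj⟩ : U) ∈ range e := by
      rw [hrange]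
      show f x - f y = 0
      exact sub_eq_zero.2 hfxy
    obtain ⟨z, hz⟩ := hmem
    refine ⟨z, ?_, ?_⟩
    · show (oR (e z).1).1 = x
      rw [hz]
      rfl
    · show (oR (e z).1).2 = y
      rw [hz]
      rfl
  -- the swap involution, lifted to `Z`
  have hswap : ∀ z, ∃ z', π₁ z' = π₂ z ∧ π₂ z' = π₁ z := fun z =>
    hhit _ _ (e z).2.1.symm (hlevel z).symm
  choose τ hτ₁ hτ₂ using hswap
  have hτs : ContMDiff (𝓡 m) (𝓡 m) ∞ τ := by
    -- `val ∘ e : Z → V` is an immersion and a topological embedding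
    let ι : Z → V := Subtype.val ∘ e
    have hιs : ContMDiff (𝓡 m) (𝓡 (n + n)) ∞ ι := hval.comp hes
    have hιd : ∀ z, Injective (mfderiv (𝓡 m) (𝓡 (n + n)) ι z) := by
      intro z
      have hc : mfderiv (𝓡 m) (𝓡 (n + n)) ι z =
          (mfderiv (𝓡 (n + n)) (𝓡 (n + n)) (Subtype.val : U → V) (e z)).comp
            (mfderiv (𝓡 m) (𝓡 (n + n)) e z) :=
        mfderiv_comp z (g := (Subtype.val : U → V)) (f := e) (mdifferentiableAt_subtype_val _) (hed z)
      intro u u' huu'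
      have h' : mfderiv (𝓡 (n + n)) (𝓡 (n + n)) (Subtype.val : U → V) (e z)
          (mfderiv (𝓡 m) (𝓡 (n + n)) e z u) =
          mfderiv (𝓡 (n + n)) (𝓡 (n + n)) (Subtype.val : U → V) (e z)
            (mfderiv (𝓡 m) (𝓡 (n + n)) e z u') := by
        have := huu'
        rw [hc] at this
        exact this
      rw [DFunLike.congr_fun (mfderiv_subtype_val (I := 𝓡 (n + n)) (e z)),
        DFunLike.congr_fun (mfderiv_subtype_val (I := 𝓡 (n + n)) (e z))] at h'
      exact heinj z h'
    have hιimm : Manifold.IsImmersion (𝓡 m) (𝓡 (n + n)) ∞ ι :=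
      Literature.Topology.FourManifolds.isImmersion_of_injective_mfderiv hιs (by simp) hιd
    have hιemb : Topology.IsEmbedding ι := Topology.IsEmbedding.subtypeVal.comp he.isEmbedding
    -- `ι ∘ τ = σ ∘ ι` for the smooth swap `σ` of `V`
    let σ : V → V := fun v => tR ((oR v).2, (oR v).1)
    have hσ : ContMDiff (𝓡 (n + n)) (𝓡 (n + n)) ∞ σ :=
      (Remodel.contMDiff_toRemodel I₂ L (M := M × M) (n := ∞)).comp
        ((contMDiff_snd.prodMk contMDiff_fst).comp hoR)
    have hcomm : ι ∘ τ = σ ∘ ι := by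
      funext z
      show (e (τ z)).1 = tR ((oR (e z).1).2, (oR (e z).1).1)
      have h1 : oR (e (τ z)).1 = ((oR (e z).1).2, (oR (e z).1).1) := Prod.ext (hτ₁ z) (hτ₂ z)
      have h2 := congrArg tR h1
      exact h2
    rw [ContMDiff.iff_comp_isImmersion hιimm, hιemb.continuous_iff, hcomm]
    exact ⟨(hσ.comp hιs).continuous, hσ.comp hιs⟩
  -- conclusion
  refine ⟨Z, inferInstance, inferInstance, inferInstance, inferInstance, inferInstance, inferInstance,
    π₁, π₂, hπ₁, hπ₂, fun z => (e z).2.1, hlevel, hPinj, hhit, htan, himm₁, himm₂, τ, hτs, hτ₁, hτ₂⟩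

/-! ### Triple points: the two sheets of the double-point immersion are transverse -/

omit [T2Space M] [SecondCountableTopology M] [IsManifold (𝓡 n) ∞ M] in
/-- **At a triple point the sheets of `π₁ : Z → M` are transverse.** Let `(Z, π₁, π₂)` be a
double-point manifold of `f` as in `exists_doublePointManifold` (only the listed properties are
used) and assume the triple points of `f` are transverse in the sense of
`TriplePointsGenericity.lean`. If `z ≠ z'` have `π₁ z = π₁ z'` (so that
`x = π₁ z, π₂ z, π₂ z'` is a triple point of `f`), then
`(u, u') ↦ dπ₁(z) u + dπ₁(z') u'` is onto `T_x M`. [cite: Kirby1989, Ch. VI p. 40; HirschDT1976, Ch. 3 §2 Ex. 2] -/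
theorem surjective_add_ediff_of_triplePoints_transverse {m : ℕ} {Z : Type*} [TopologicalSpace Z]
    [ChartedSpace (𝔼 m) Z] {π₁ π₂ : Z → M} {f : M → 𝔼 q}
    (hne : ∀ z, π₁ z ≠ π₂ z) (hlevel : ∀ z, f (π₁ z) = f (π₂ z))
    (hinj : Injective fun z => (π₁ z, π₂ z))
    (htan : ∀ (z : Z) (ζ : 𝔼 n × 𝔼 n), ediff n q f (π₁ z) ζ.1 = ediff n q f (π₂ z) ζ.2 ↔
      ∃ u : 𝔼 m, (mfderiv (𝓡 m) (𝓡 n) π₁ z u, mfderiv (𝓡 m) (𝓡 n) π₂ z u) = ζ)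
    (htp : ∀ x y w : M, x ≠ y → y ≠ w → x ≠ w → f x = f y → f y = f w →
      ∀ W : 𝔼 q × 𝔼 q, ∃ ζ : 𝔼 n × 𝔼 n × 𝔼 n,
        (ediff n q f x ζ.1 - ediff n q f y ζ.2.1, ediff n q f y ζ.2.1 - ediff n q f w ζ.2.2) = W)
    {z z' : Z} (hzz' : z ≠ z') (h : π₁ z = π₁ z') (τ : 𝔼 n) :
    ∃ u u' : 𝔼 m, ediff m n π₁ z u + ediff m n π₁ z' u' = τ := by
  -- the triple `(π₂ z, π₁ z, π₂ z')`
  have h1 : π₂ z ≠ π₁ z := (hne z).symm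
  have h3 : π₂ z ≠ π₂ z' := fun h' => hzz' (hinj (Prod.ext h h'))
  have h2 : π₁ z ≠ π₂ z' := h ▸ hne z'
  have hf1 : f (π₂ z) = f (π₁ z) := (hlevel z).symm
  have hf2 : f (π₁ z) = f (π₂ z') := h ▸ hlevel z'
  obtain ⟨ζ, hζ⟩ := htp _ _ _ h1 h2 h3 hf1 hf2 (0, ediff n q f (π₁ z) τ)
  obtain ⟨e1, e2⟩ := Prod.ext_iff.1 hζ
  simp only at e1 e2
  -- `(ζ.2.1, ζ.1)` is tangent at `z`
  obtain ⟨u, hu⟩ := (htan z (ζ.2.1, ζ.1)).1 (sub_eq_zero.1 e1).symm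
  -- `(τ - ζ.2.1, -ζ.2.2)` is tangent at `z'`
  have ht' : ediff n q f (π₁ z') (τ - ζ.2.1) = ediff n q f (π₂ z') (-ζ.2.2) := by
    rw [← h, map_sub, map_neg, ← e2]
    abel
  obtain ⟨u', hu'⟩ := (htan z' (τ - ζ.2.1, -ζ.2.2)).1 ht'
  refine ⟨u, u', ?_⟩
  have hu1 : ediff m n π₁ z u = ζ.2.1 := congrArg Prod.fst hu
  have hu2 : ediff m n π₁ z' u' = τ - ζ.2.1 := congrArg Prod.fst hu'
  rw [hu1, hu2]
  abel

end Literature.Topology.Immersions
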